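import Summits.SmoothPoincare4.SmoothPoincare4.Theorems.ConvexBisectionAcyclicBisectionExistsStabilisationAngles
import HarnessLib

/-!
# N3 (`stub_STgeo`) ▸ N3-nat ▸ N3d-1: CALCULUS OF THE MODEL CROSSING ARC `crossVec u s = (sin s, cos s · u)`
(wave 7, brick H6-7 of stub `stub_STgeo` = node N3 of NF4, line `modp-braid-orbits`, crux
`ConvexBisection.AcyclicBisectionExists`, item stmt-SmoothPoincare4-10508; registered sub-goal
`helper_hasDerivAt_crossVec`; vocabulary `…StabilisationData.lean` (H6-1), companions in
`…StabilisationAngles.lean` §2 (H6-2: `lamSq_crossVec`, `norm_crossVec`, `crossVec_zero`).)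

Clause `A_cross`/`B_cross` of `StabBaseData` puts the block curve near its crossing with the belt sphere
`{x_λ = 0}` of a 1-handle in MODEL POSITION `s ↦ E.jB i (crossVec u s)`.  For the curve constructor of
N3d-1 (smooth embedding near the crossing, single transverse crossing) this file records: `crossVec u` is
smooth (`contDiff_crossVec`) with derivative `(cos s, −sin s · u)` (`hasDerivAt_crossVec`, registered
`helper_hasDerivAt_crossVec`), at `s = 0` the unit vector `e₀` NORMAL to the belt sphere
(`hasDerivAt_crossVec_zero`, `deriv_crossVec_zero_apply_zero`: the crossing is transverse), its
`x_λ`-coordinate `sin s` is strictly monotone on `[−π/2, π/2]` so the arc is injective there and meets the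
belt sphere only at `s = 0` (`crossVec_injOn`, `crossVec_apply_zero_eq_zero_iff`; cf. `lamSq_crossVec_ne_zero` of H6-2).  Everything is proved; no
definitions.  References: A. A. Kosinski, *Differential Manifolds* (1993), VI §6–7 (belt sphere, transverse
one-point intersection in the cancellation lemma (7.4)) [Kosinski1993].
-/

noncomputable section

-- the prescribed namespace `Summit.<P>.<Sub>.…` duplicates `SmoothPoincare4` (P = Sub)
set_option linter.dupNamespace false

open scoped Real Topology ContDiff
open Set Function

namespace Summit.SmoothPoincare4.SmoothPoincare4.Theorems.AcyclicBisectionExists.ModpBraidOrbits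

namespace StabilisationData

/-- The crossing arc as a `toLp` of a coordinate function. [folklore] -/
theorem crossVec_eq (u : EuclideanSpace ℝ (Fin 3)) (s : ℝ) :
    crossVec u s = WithLp.toLp 2 (fun i : Fin 4 =>
      (![Real.sin s, Real.cos s * u 0, Real.cos s * u 1, Real.cos s * u 2] : Fin 4 → ℝ) i) := rfl

/-- **The crossing arc is smooth.** [folklore] -/
theorem contDiff_crossVec (u : EuclideanSpace ℝ (Fin 3)) : ContDiff ℝ ∞ (crossVec u) := by
  rw [show crossVec u = fun s => WithLp.toLp 2 (fun i : Fin 4 =>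
      (![Real.sin s, Real.cos s * u 0, Real.cos s * u 1, Real.cos s * u 2] : Fin 4 → ℝ) i) from
    funext (crossVec_eq u)]
  refine PiLp.contDiff_toLp.comp ?_
  rw [contDiff_pi]
  intro i
  fin_cases i <;> simp <;> fun_prop

/-- **The derivative of the crossing arc**: `d/ds (sin s, cos s · u) = (cos s, −sin s · u)`. [folklore] -/
theorem hasDerivAt_crossVec (u : EuclideanSpace ℝ (Fin 3)) (s : ℝ) :
    HasDerivAt (crossVec u)
      (WithLp.toLp 2 ![Real.cos s, -Real.sin s * u 0, -Real.sin s * u 1, -Real.sin s * u 2]) s := by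
  have hF : HasDerivAt (fun s (i : Fin 4) =>
      (![Real.sin s, Real.cos s * u 0, Real.cos s * u 1, Real.cos s * u 2] : Fin 4 → ℝ) i)
      (![Real.cos s, -Real.sin s * u 0, -Real.sin s * u 1, -Real.sin s * u 2] : Fin 4 → ℝ) s := by
    refine hasDerivAt_pi.2 fun i => ?_
    fin_cases i
    · simpa using Real.hasDerivAt_sin s
    · simpa using (Real.hasDerivAt_cos s).mul_const (u 0)
    · simpa using (Real.hasDerivAt_cos s).mul_const (u 1)
    · simpa using (Real.hasDerivAt_cos s).mul_const (u 2)
  have h := ((PiLp.continuousLinearEquiv 2 ℝ (fun _ : Fin 4 => ℝ)).symm :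
    (Fin 4 → ℝ) →L[ℝ] EuclideanSpace ℝ (Fin 4)).hasFDerivAt.comp_hasDerivAt s hF
  exact h

/-- At the crossing the velocity is `e₀ = (1, 0, 0, 0)`, the unit normal of the belt sphere `{x_λ = 0}`:
the crossing is transverse. [folklore] -/
theorem hasDerivAt_crossVec_zero (u : EuclideanSpace ℝ (Fin 3)) :
    HasDerivAt (crossVec u) (EuclideanSpace.single (0 : Fin 4) (1 : ℝ)) 0 := by
  convert hasDerivAt_crossVec u 0 using 1
  ext i
  fin_cases i <;> simp

/-- The `x_λ`-component of the velocity at the crossing is `1 ≠ 0`. [folklore] -/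
theorem deriv_crossVec_zero_apply_zero (u : EuclideanSpace ℝ (Fin 3)) : deriv (crossVec u) 0 0 = 1 := by
  rw [(hasDerivAt_crossVec_zero u).deriv]
  simp

/-- **The crossing arc meets the belt sphere `{x_λ = 0}` only at `s = 0`** on `(−π, π)`. [folklore] -/
theorem crossVec_apply_zero_eq_zero_iff (u : EuclideanSpace ℝ (Fin 3)) {s : ℝ} (hs : s ∈ Ioo (-π) π) :
    crossVec u s 0 = 0 ↔ s = 0 := by
  rw [crossVec_apply_zero]
  refine ⟨fun h => ?_, fun h => by rw [h, Real.sin_zero]⟩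
  by_contra hs0
  rcases lt_or_gt_of_ne hs0 with hlt | hgt
  · have := Real.sin_neg_of_neg_of_neg_pi_lt hlt hs.1; linarith
  · have := Real.sin_pos_of_pos_of_lt_pi hgt hs.2; linarith

/-- **The crossing arc is injective on `[−π/2, π/2]`** (its `x_λ`-coordinate `sin` is). [folklore] -/
theorem crossVec_injOn (u : EuclideanSpace ℝ (Fin 3)) : InjOn (crossVec u) (Icc (-(π / 2)) (π / 2)) := by
  intro s hs t ht h
  have h0 : Real.sin s = Real.sin t := by
    have := congrArg (fun v : EuclideanSpace ℝ (Fin 4) => v 0) h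
    simpa [crossVec_apply_zero] using this
  exact Real.injOn_sin hs ht h0

/-- The crossing arc is continuous. [folklore] -/
theorem continuous_crossVec (u : EuclideanSpace ℝ (Fin 3)) : Continuous (crossVec u) :=
  (contDiff_crossVec u).continuous

end StabilisationData

/-! ## Registered helper -/

/-- **Registered helper `helper_hasDerivAt_crossVec` (sub-goal of `stub_STgeo` ▸ N3-nat ▸ N3d-1 curves,
wave 7, lead c5): the derivative of the model crossing arc of clause `A_cross` of `StabBaseData`.** [folklore] -/
theorem helper_hasDerivAt_crossVec : ∀ (u : EuclideanSpace ℝ (Fin 3)) (s : ℝ), HasDerivAt (Summit.SmoothPoincare4.SmoothPoincare4.Theorems.AcyclicBisectionExists.ModpBraidOrbits.crossVec u) (WithLp.toLp 2 ![Real.cos s, -Real.sin s * u 0, -Real.sin s * u 1, -Real.sin s * u 2]) s :=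
  fun u s => StabilisationData.hasDerivAt_crossVec u s

end Summit.SmoothPoincare4.SmoothPoincare4.Theorems.AcyclicBisectionExists.ModpBraidOrbits

end
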